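import Mathlib
import HarnessLib
import Summits.HubbardSuperconductivity.HubbardSuperconductivity.Theorems.KLProgrammeKLRegimeTwoVolumeTowerBaseFrameDiffUniform
import Summits.HubbardSuperconductivity.HubbardSuperconductivity.Theorems.KLProgrammeH10TwoPointLimitFramePerturbation
import Summits.HubbardSuperconductivity.HubbardSuperconductivity.Theorems.KLProgrammeKLRegimeEngineScaleZeroE1Regime
import Summits.HubbardSuperconductivity.HubbardSuperconductivity.Theorems.KLProgrammeKLRegimeEngineSymbolThresholds

/-!
# Route `KLProgramme` — crux K3, VL child `KLRegimeVolumeLimitV17F2` (stmt-HubbardSuperconductivity-20440), base of the two-volume tower, atom (ii)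
# (`hDrow/hDcol` = conjuncts 4–5 of atom `Hbase` / conjuncts (ii) of `HB0`) IN THE KL REGIME: every model hypothesis of
# `klBaseTransfer_frameDiff_rows_uniform` discharged from the ENGINE BINDERS, leaving only the two admissible frames and their increment `ε`
# (cell gate-hubbard-kl, seat p3 g18; `--supports` 20440)

`…TowerBaseFrameDiffUniform.klBaseTransfer_frameDiff_rows_uniform` bounds the rows/columns of `klBaseTransfer L M β μ K′ − klBaseTransfer L M β μ K`
by `2·√(131072·C₁·c_β)·Amp(ε)`, `Amp` linear in the frame increment `ε`, under model data (frames of common `C²` size `A`, `0 < z ≤ 1`,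
`klE0 + A + z² < −μ`, `klE0 + A − μ ≤ 3`, `β ≥ 1`, `klE0·β < π(2M−3)`, `4π ≤ zL`, a derivative bound of `bgmCutoffSq klE0`, `C²` sizes of the one-factor
angular factors).  Here, following p3 g10's `…SectorMultiplierPairWtRegime` pattern, all of it is discharged under the scale-`0` engine binders:
`A := 1/40` by `norm_iteratedFDeriv_frameShift_le_of_frameOK_regime` (`c ≤ 1/(120(Gfr₂+1))`, `U ≤ min 1 (1/(240(Gfr₀+Gfr₁+1)))`), `z := 1/10` on
`klWindowC = [−1.05, −0.15]`, `40π ≤ 2¹⁵ ≤ L` and `klE0·β ≤ π(2M−13)` by `scaleZero_regime_sizes`, the cutoff bound by `exists_abs_derivs3_bgmCutoffSq_le`,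
the angular sizes by `angularFactor₁_compactSupport_derivBounds` summed over the two sectors:

* `exists_uniform_angularFactor₁_sizes` — ONE pair `(z₁, z₂)` for both sectors of scale `0`;
* **`klBaseTransfer_frameDiff_rows_regime`** (and its `klEngC₃3/klEngU₀3`-keyed twin **`klBaseTransfer_frameDiff_rows_klEng3`**) — for `R.WF`, `0 < c ≤ 1/(120(Gfr₂+1))`, `0 < U ≤ min 1 (1/(240(Gfr₀+Gfr₁+1)))`, `μ ∈ klWindowC`,
  `klBetaMin ≤ β ≤ e^{c/U²}`: `∃ Cfd ≥ 0` (depending on `β`, `R`-free given the doors) such that for all `L ≥ klEngL₃ β U`, `M ≥ klEngM₃ β U L`, all pairs of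
  admissible frames `FrameOK R U (nScales β) μ K`, `… K′` and every `ε ≥ max_{j≤2} coeffNorm_j(K′ ⊖ K)`: the rows AND columns of
  `klBaseTransfer L M β μ K′ − klBaseTransfer L M β μ K` are `≤ Cfd·ε`.  In the tower: `(K′, K) = (K_{bL}, K_L)` on the fine volume, `ε = O(1/L)`
  (the two-volume frame rate), so `δg L := Cfd·ε_L → 0` — conjuncts (ii) of `HB0` (`…V11HbaseOfAtoms`).

Proofs only; no definition.  Honest framing: regime bookkeeping over landed bounds; nothing here asserts any stub of 20440, K3, VL or superconductivity.
[cite: BenfattoGiulianiMastropietro2006, §2.7 (2.70)–(2.71a), §3 (3.3)]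
-/

noncomputable section

namespace Summit.HubbardSuperconductivity.HubbardSuperconductivity.Theorems.TorusFourierL2

set_option linter.dupNamespace false -- summit = problem name (single-conjunct summit), D-0017

open Set Finset Literature.MathematicalPhysics.QuantumLattice Literature.MathematicalPhysics.QuantumLattice.BandSectorCounting
open Literature.MathematicalPhysics.QuantumLattice.FermiRG Literature.Probability.LatticeModels Literature.Analysis.SpecialFunctions
open Summit.HubbardSuperconductivity.HubbardSuperconductivity.Theorems.DispersionFlow
open Summit.HubbardSuperconductivity.HubbardSuperconductivity.Theorems.KLRegimeSplit
open Summit.HubbardSuperconductivity.HubbardSuperconductivity.Theorems.KLProgrammeLegKernels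
open Summit.HubbardSuperconductivity.HubbardSuperconductivity.Theorems.PerturbedFermiCurve
open Summit.HubbardSuperconductivity.HubbardSuperconductivity.Theorems.EngineV8
open Summit.HubbardSuperconductivity.HubbardSuperconductivity.Theorems.TwoVolumeDefect
open Summit.HubbardSuperconductivity.HubbardSuperconductivity.Theorems.TwoVolumeSource
open scoped Real

/-- **ONE pair of global `C²` sizes for the one-factor angular factors of BOTH scale-`0` sectors** (sum of the per-sector sizes). [folklore] -/
theorem exists_uniform_angularFactor₁_sizes {z : ℝ} (hz : 0 < z) :
    ∃ z₁ z₂ : ℝ, 0 ≤ z₁ ∧ 0 ≤ z₂ ∧ ∀ ω : Fin (sectorCount 0), ∀ p,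
      ‖fderiv ℝ (fun p : Fin 2 → ℝ => gnCutoff ((π + z) ^ 2 / π ^ 2) ((π + z) ^ 2) (p 0 ^ 2) * gnCutoff ((π + z) ^ 2 / π ^ 2) ((π + z) ^ 2) (p 1 ^ 2) *
        (radialCutoffC (1 / 2) (momToComplex p) * sectorWeightCirc 0 ((ω : ℕ) : ℤ) (polarAngle p))) p‖ ≤ z₁ ∧
      ‖iteratedFDeriv ℝ 2 (fun p : Fin 2 → ℝ => gnCutoff ((π + z) ^ 2 / π ^ 2) ((π + z) ^ 2) (p 0 ^ 2) *
        gnCutoff ((π + z) ^ 2 / π ^ 2) ((π + z) ^ 2) (p 1 ^ 2) *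
        (radialCutoffC (1 / 2) (momToComplex p) * sectorWeightCirc 0 ((ω : ℕ) : ℤ) (polarAngle p))) p‖ ≤ z₂ := by
  classical
  have h : ∀ ω : Fin (sectorCount 0), ∃ z₁ z₂ : ℝ, 0 ≤ z₁ ∧ 0 ≤ z₂ ∧ (∀ p,
      ‖fderiv ℝ (fun p : Fin 2 → ℝ => gnCutoff ((π + z) ^ 2 / π ^ 2) ((π + z) ^ 2) (p 0 ^ 2) * gnCutoff ((π + z) ^ 2 / π ^ 2) ((π + z) ^ 2) (p 1 ^ 2) *
        (radialCutoffC (1 / 2) (momToComplex p) * sectorWeightCirc 0 ((ω : ℕ) : ℤ) (polarAngle p))) p‖ ≤ z₁) ∧ (∀ p,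
      ‖iteratedFDeriv ℝ 2 (fun p : Fin 2 → ℝ => gnCutoff ((π + z) ^ 2 / π ^ 2) ((π + z) ^ 2) (p 0 ^ 2) *
        gnCutoff ((π + z) ^ 2 / π ^ 2) ((π + z) ^ 2) (p 1 ^ 2) *
        (radialCutoffC (1 / 2) (momToComplex p) * sectorWeightCirc 0 ((ω : ℕ) : ℤ) (polarAngle p))) p‖ ≤ z₂) :=
    fun ω => (angularFactor₁_compactSupport_derivBounds (n := 0) (ω := ((ω : ℕ) : ℤ)) (fun _ => rfl) hz).2
  choose f₁ f₂ hf using h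
  refine ⟨∑ ω, f₁ ω, ∑ ω, f₂ ω, Finset.sum_nonneg fun ω _ => (hf ω).1, Finset.sum_nonneg fun ω _ => (hf ω).2.1, fun ω p => ⟨?_, ?_⟩⟩
  · exact ((hf ω).2.2.1 p).trans (Finset.single_le_sum (fun ω' _ => (hf ω').1) (Finset.mem_univ ω))
  · exact ((hf ω).2.2.2 p).trans (Finset.single_le_sum (fun ω' _ => (hf ω').2.1) (Finset.mem_univ ω))

set_option maxHeartbeats 800000 in -- one large application
/-- **BASE ATOM (ii) IN THE KL REGIME** (see the module docstring): `∃ Cfd ≥ 0` with rows and columns of the base-transfer frame difference `≤ Cfd·ε` for every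
admissible pair of frames with increment `≤ ε`, uniformly in `L ≥ klEngL₃ β U`, `M ≥ klEngM₃ β U L`. [cite: BenfattoGiulianiMastropietro2006, §2.7 (2.70)–(2.71a), §3 (3.3)] -/
theorem klBaseTransfer_frameDiff_rows_regime {R : RenConsts} (hR : R.WF) {c U μ β : ℝ} (hc : 0 < c) (hcle : c ≤ 1 / (120 * (R.Gfr 2 + 1)))
    (hU : 0 < U) (hUle : U ≤ min 1 (1 / (240 * (R.Gfr 0 + R.Gfr 1 + 1)))) (hμ : μ ∈ klWindowC) (hβmin : klBetaMin ≤ β)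
    (hβc : β ≤ Real.exp (c / U ^ 2)) :
    ∃ Cfd : ℝ, 0 ≤ Cfd ∧ ∀ (L M : ℕ) [NeZero L] [NeZero M], klEngL₃ β U ≤ L → klEngM₃ β U L ≤ M →
      ∀ (K K' : TrigPolyC4v), FrameOK R U (nScales β) μ K → FrameOK R U (nScales β) μ K' →
      ∀ ε : ℝ, (∀ j ≤ 2, (fsub K' K).coeffNorm j ≤ ε) →
        (∀ x : SrcLabel L M 0, ∑ y : GridLeg (GridPoint L (klGridN M)) × Fin 2,
            ‖klBaseTransfer L M β μ K' x y - klBaseTransfer L M β μ K x y‖ ≤ Cfd * ε) ∧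
        (∀ y : GridLeg (GridPoint L (klGridN M)) × Fin 2, ∑ x : SrcLabel L M 0,
            ‖klBaseTransfer L M β μ K' x y - klBaseTransfer L M β μ K x y‖ ≤ Cfd * ε) := by
  have hGfr : ∀ j, 0 ≤ R.Gfr j := hR.2.2
  have hπ := Real.pi_pos
  have he : (0 : ℝ) < klE0 := by norm_num [klE0]
  have hβ1 : 1 ≤ β := le_trans (by norm_num [klBetaMin]) hβmin
  have hβ0 : 0 < β := by linarith
  -- the absolute constants: `A := 1/40`, `z := 1/10`, the cutoff bound, the angular sizes
  obtain ⟨d₀, hd₀, hd₀1, hd₀2, hd₀3⟩ := exists_abs_derivs3_bgmCutoffSq_le he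
  have hz : (0 : ℝ) < 1 / 10 := by norm_num
  obtain ⟨z₁, z₂, hz₁, hz₂, hZb⟩ := exists_uniform_angularFactor₁_sizes hz
  set A : ℝ := 1 / 40 with hAdef
  -- the window margins
  have hμ' := hμ
  simp only [klWindowC, Set.mem_Icc] at hμ'
  have e1 : (-1.05 : ℝ) = -(21 / 20) := by norm_num
  have e2 : (-0.15 : ℝ) = -(3 / 20) := by norm_num
  have hμlo : -(21 / 20 : ℝ) ≤ μ := by rw [← e1]; exact hμ'.1
  have hμhi : μ ≤ -(3 / 20 : ℝ) := by rw [← e2]; exact hμ'.2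
  have he0 : klE0 = 1 / 32 := rfl
  have hgap : klE0 + A + (1 / 10 : ℝ) ^ 2 < -μ := by rw [he0, hAdef]; linarith only [hμhi]
  have h3 : klE0 + A - μ ≤ 3 := by rw [he0, hAdef]; linarith only [hμlo]
  -- the constant (ε = 1 in the linear amplitude)
  set Camp : ℝ := d₀ * klE0 ^ 2 / klScale klE0 0 ^ 2 * (2 * (4 + A + |μ|) * 1 * 1) +
        (4 * (d₀ * klE0 ^ 6 / klScale klE0 0 ^ 2) + 2 * (d₀ * klE0 ^ 4 / klScale klE0 0 ^ 2)) *
          (2 * π / β) ^ 2 * (2 * (4 + A + |μ|) * 1 * 1) / klScale klE0 0 ^ 2 * β ^ 2 +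
        π ^ 2 *
          (((4 * (d₀ * klE0 ^ 6 / klScale klE0 0 ^ 2) + 2 * (d₀ * klE0 ^ 4 / klScale klE0 0 ^ 2)) * (4 + 2 * A) ^ 2 / klScale klE0 0 ^ 2 +
                2 * (d₀ * klE0 ^ 4 / klScale klE0 0 ^ 2) * (4 + 4 * A) / klScale klE0 0) * (2 * (4 + A + |μ|) * 1 * 1) +
            4 * (d₀ * klE0 ^ 4 / klScale klE0 0 ^ 2) * (4 + 2 * A) / klScale klE0 0 *
              (2 * (((4 + 2 * A) * 1 + (4 + A + |μ|) * (2 * 1)) * 1 + (4 + A + |μ|) * 1 * z₁)) +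
            d₀ * klE0 ^ 2 / klScale klE0 0 ^ 2 *
              (2 * (((4 + 4 * A) * 1 + 2 * (4 + 2 * A) * (2 * 1) + (4 + A + |μ|) * (4 * 1)) * 1 +
                2 * ((4 + 2 * A) * 1 + (4 + A + |μ|) * (2 * 1)) * z₁ + (4 + A + |μ|) * 1 * z₂))) / 4 with hCamp
  set Cpre : ℝ := Real.sqrt (131072 * (4 * ((2 * Real.sqrt 2 / 1 + 2) * (2 * Real.sqrt 2 / 1 + 2)) + 16 * (1 / 1 + 1) ^ 2) *
        ((klE0 * β / π + 1) * (1793 * klE0 + 704))) with hCpre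
  have hΛ : 0 < klScale klE0 0 := by rw [klScale]; norm_num [klE0]
  have hA0 : (0 : ℝ) ≤ A := by rw [hAdef]; norm_num
  have hCamp0 : 0 ≤ Camp := by rw [hCamp]; positivity
  have hCpre0 : 0 ≤ Cpre := Real.sqrt_nonneg _
  refine ⟨2 * Cpre * Camp, by positivity, ?_⟩
  intro L M _ _ hL hM K K' hK hK' ε hε
  -- the frames' common `C²` size `≤ 1/40`
  have hlog : 1 ≤ Real.log 4 := by
    have h4 : Real.exp 1 ≤ 4 := by have := Real.exp_one_lt_d9; norm_num at this; linarith
    calc (1 : ℝ) = Real.log (Real.exp 1) := (Real.log_exp 1).symm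
      _ ≤ Real.log 4 := Real.log_le_log (Real.exp_pos 1) h4
  have hAK : ∀ (K₀ : TrigPolyC4v), FrameOK R U (nScales β) μ K₀ → ∀ p : Momentum, ∀ j ≤ 2, ‖iteratedFDeriv ℝ j (frameShift K₀) p‖ ≤ A := by
    intro K₀ hK₀ p j hj
    refine (norm_iteratedFDeriv_frameShift_le_of_frameOK_regime hGfr hc.le hβmin hβc hK₀ p hj).trans ?_
    have h0 := hGfr 0; have h1 := hGfr 1; have h2 := hGfr 2
    have hU1 : U ≤ 1 := hUle.trans (min_le_left _ _)
    have hUk : U ≤ 1 / (240 * (R.Gfr 0 + R.Gfr 1 + 1)) := hUle.trans (min_le_right _ _)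
    rw [abs_of_pos hU]
    have hU2 : U ^ 2 ≤ U := by nlinarith only [hU, hU1]
    have hA1 : 2 * R.Gfr 0 * U + 2 * R.Gfr 1 * U ^ 2 ≤ 2 * (R.Gfr 0 + R.Gfr 1 + 1) * U := by
      have := mul_le_mul_of_nonneg_left hU2 h1
      nlinarith only [this, hU.le, h0, h1]
    have hB1 : 2 * (R.Gfr 0 + R.Gfr 1 + 1) * U ≤ 1 / 120 := by
      have hpos : 0 < 240 * (R.Gfr 0 + R.Gfr 1 + 1) := by positivity
      have := (le_div_iff₀ hpos).mp hUk
      linarith only [this]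
    have hC1 : R.Gfr 2 * (c / Real.log 4) ≤ R.Gfr 2 * c := mul_le_mul_of_nonneg_left (div_le_self hc.le hlog) h2
    have hD1 : R.Gfr 2 * c ≤ 1 / 120 := by
      have hpos : 0 < 120 * (R.Gfr 2 + 1) := by positivity
      have := (le_div_iff₀ hpos).mp hcle
      nlinarith only [this, hc.le, h2]
    rw [hAdef]; linarith only [hA1, hB1, hC1, hD1]
  -- the scale thresholds
  obtain ⟨hL15, -, -, hβM, -, -⟩ := scaleZero_regime_sizes hβmin hL hM
  have hβ128 : (128 : ℝ) ≤ β := by simpa [klBetaMin] using hβmin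
  have hMβ : klE0 * β < π * (2 * M - 3) := by
    have hπ3 : (3 : ℝ) < π := Real.pi_gt_three
    have h2M : β ≤ 2 * (M : ℝ) - 3 := by linarith
    have h2M0 : 0 < 2 * (M : ℝ) - 3 := by linarith
    rw [he0]
    nlinarith
  have hL0 : (0 : ℝ) < L := Nat.cast_pos.2 (Nat.pos_of_ne_zero (NeZero.ne L))
  have hzL : 2 * |2 * π / (L : ℝ)| ≤ 1 / 10 := by
    rw [abs_of_pos (by positivity)]
    rw [show 2 * (2 * π / (L : ℝ)) = 4 * π / L by ring, div_le_iff₀ hL0]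
    have hπ4 : π < 4 := Real.pi_lt_four
    have h215 : (2 : ℝ) ^ 15 = 32768 := by norm_num
    rw [h215] at hL15
    nlinarith
  -- the uniform bound at `A`, `z := 1/10`, `d := d₀`
  have hmain := klBaseTransfer_frameDiff_rows_uniform (hAK K hK) (hAK K' hK') hz (by norm_num) hgap h3 hβ1 hMβ hd₀ hd₀1 hd₀2 hd₀3 hZb hε
    hK hK' hzL
  -- the amplitude is linear in `ε`
  have hε0 : 0 ≤ ε := le_trans (TrigPolyC4v.coeffNorm_nonneg 0 _) (hε 0 (by norm_num))
  have hlin : Cpre *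
      (d₀ * klE0 ^ 2 / klScale klE0 0 ^ 2 * (2 * (4 + A + |μ|) * ε * 1) +
        (4 * (d₀ * klE0 ^ 6 / klScale klE0 0 ^ 2) + 2 * (d₀ * klE0 ^ 4 / klScale klE0 0 ^ 2)) *
          (2 * π / β) ^ 2 * (2 * (4 + A + |μ|) * ε * 1) / klScale klE0 0 ^ 2 * β ^ 2 +
        π ^ 2 *
          (((4 * (d₀ * klE0 ^ 6 / klScale klE0 0 ^ 2) + 2 * (d₀ * klE0 ^ 4 / klScale klE0 0 ^ 2)) * (4 + 2 * A) ^ 2 / klScale klE0 0 ^ 2 +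
                2 * (d₀ * klE0 ^ 4 / klScale klE0 0 ^ 2) * (4 + 4 * A) / klScale klE0 0) * (2 * (4 + A + |μ|) * ε * 1) +
            4 * (d₀ * klE0 ^ 4 / klScale klE0 0 ^ 2) * (4 + 2 * A) / klScale klE0 0 *
              (2 * (((4 + 2 * A) * ε + (4 + A + |μ|) * (2 * ε)) * 1 + (4 + A + |μ|) * ε * z₁)) +
            d₀ * klE0 ^ 2 / klScale klE0 0 ^ 2 *
              (2 * (((4 + 4 * A) * ε + 2 * (4 + 2 * A) * (2 * ε) + (4 + A + |μ|) * (4 * ε)) * 1 +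
                2 * ((4 + 2 * A) * ε + (4 + A + |μ|) * (2 * ε)) * z₁ + (4 + A + |μ|) * ε * z₂))) / 4) = Cpre * Camp * ε := by
    rw [hCamp]; ring
  refine ⟨fun x => (hmain.1 x).trans (le_of_eq ?_), fun y => (hmain.2 y).trans (le_of_eq ?_)⟩
  · linear_combination (2 : ℝ) * hlin
  · linear_combination (2 : ℝ) * hlin

/-- **BASE ATOM (ii) AT THE ENGINE THRESHOLDS `klEngC₃3`, `klEngU₀3`** (one `le_trans` per door: `klEngC₃3 ≤ (1/10)/(12(Gfr₂+1))`,
`klEngU₀3 ≤ min 1 ((1/10)/(24(Gfr₀+Gfr₁+1)))`, `…EngineSymbolThresholds`): the conclusion of `klBaseTransfer_frameDiff_rows_regime` under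
`0 < c ≤ klEngC₃3 P R`, `0 < U ≤ klEngU₀3 P R c` (any `P`). [cite: BenfattoGiulianiMastropietro2006, §2.7 (2.70)–(2.71a), §3 (3.3)] -/
theorem klBaseTransfer_frameDiff_rows_klEng3 (P : SplitConsts) {R : RenConsts} (hR : R.WF) {c U μ β : ℝ} (hc : 0 < c) (hc₃ : c ≤ klEngC₃3 P R)
    (hU : 0 < U) (hU₀ : U ≤ klEngU₀3 P R c) (hμ : μ ∈ klWindowC) (hβmin : klBetaMin ≤ β) (hβc : β ≤ Real.exp (c / U ^ 2)) :
    ∃ Cfd : ℝ, 0 ≤ Cfd ∧ ∀ (L M : ℕ) [NeZero L] [NeZero M], klEngL₃ β U ≤ L → klEngM₃ β U L ≤ M →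
      ∀ (K K' : TrigPolyC4v), FrameOK R U (nScales β) μ K → FrameOK R U (nScales β) μ K' →
      ∀ ε : ℝ, (∀ j ≤ 2, (fsub K' K).coeffNorm j ≤ ε) →
        (∀ x : SrcLabel L M 0, ∑ y : GridLeg (GridPoint L (klGridN M)) × Fin 2,
            ‖klBaseTransfer L M β μ K' x y - klBaseTransfer L M β μ K x y‖ ≤ Cfd * ε) ∧
        (∀ y : GridLeg (GridPoint L (klGridN M)) × Fin 2, ∑ x : SrcLabel L M 0,
            ‖klBaseTransfer L M β μ K' x y - klBaseTransfer L M β μ K x y‖ ≤ Cfd * ε) := by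
  have hκ : (1 : ℝ) / 2 ^ 100 ≤ 1 / 10 := by
    rw [div_le_div_iff₀ (by positivity) (by norm_num)]
    have : (10 : ℝ) ≤ 2 ^ 100 := by norm_num
    linarith
  have hcle : c ≤ 1 / (120 * (R.Gfr 2 + 1)) := by
    refine hc₃.trans ((klEngC₃3_le_div_of_le P (hR.2.2 2) hκ).trans (le_of_eq ?_))
    rw [div_div]; ring_nf
  have hUle : U ≤ min 1 (1 / (240 * (R.Gfr 0 + R.Gfr 1 + 1))) := by
    refine hU₀.trans ((klEngU₀3_le_min_div_of_le P (hR.2.2 0) (hR.2.2 1) c hκ).trans (le_of_eq ?_))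
    congr 1
    rw [div_div]; ring_nf
  exact klBaseTransfer_frameDiff_rows_regime hR hc hcle hU hUle hμ hβmin hβc

end Summit.HubbardSuperconductivity.HubbardSuperconductivity.Theorems.TorusFourierL2

end
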